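import Literature.ModelTheory.ExponentialFields.DefinableClosure
import Literature.ModelTheory.ExponentialFields.DefinabilityParams
import Literature.ModelTheory.ExponentialFields.OMinimalMonotonicity
import Literature.ModelTheory.Quasiminimal.PregeometryStructures
import Mathlib.Data.Set.Card
import HarnessLib

/-!
# In an o-minimal structure the definable closure is a pregeometry

Topic `Literature/ModelTheory/ExponentialFields`.  **Exchange for `dcl` in o-minimal
structures** (Pillay–Steinhorn, *Definable sets in ordered structures I* (1986), §4; den Besten
2016, Lemma 7.1.6 (iv): "if `a ∈ Dcl(A ∪ {b}) ∖ Dcl(A)`, then `b ∈ Dcl(A ∪ {a})`"), whence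
`definableClosure L` (`DefinableClosure.lean`) is a pregeometry in the sense of
`Literature.ModelTheory.Quasiminimal.IsPregeometry` (`PregeometryStructures.lean`), so that the
matroid / basis / dimension apparatus of `PregeometryMatroid.lean` applies to `dcl` in every
o-minimal structure — the dimension theory of den Besten, §7.1 (Definitions 7.1.7–7.1.13) used
in Wilkie's valuation inequality (1996, §10).

Proof of exchange (den Besten's argument, with the interior case settled by the monotonicity
theorem instead of the sets `C_l`, `C_r` of left/right endpoints).  Write `a = g(b)` for an
`A`-definable function `g` (`exists_definable_fiber`: an `(A ∪ {b})`-definable set is the fibre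
at `b` of an `A`-definable set).  The set `B' = {y | g y = a}` is `(A ∪ {a})`-definable.  If `b`
is not an interior point of `B'`, it is a boundary point; the boundary of a definable subset of
the line is definable over the same parameters and finite (`OMinimalIntervals.lean`), and the
points of a finite definable set are definable (`subset_definableClosure_of_finite`, by
repeatedly taking the least element), so `b ∈ dcl(A ∪ {a})`.  If `b` is interior, `a` belongs
to the `A`-definable set `V` of values taken by `g` on non-trivial open intervals; by the
monotonicity theorem `g` takes only finitely many values at its points of local constancy
(`finite_image_setOf_locallyConst`), so `V` is finite and `a ∈ dcl(A)`, contrary to assumption.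

* `exists_definable_fiber`, `subset_definableClosure_of_finite`,
  `finite_setOf_boundary` / `definable_setOf_boundary`, `finite_image_setOf_locallyConst`,
  `exchange_definableClosure`, `isPregeometry_definableClosure`.

Setting: `M` an `L`-structure on a dense linear order without endpoints, o-minimal
(`FirstOrder.Language.IsOMinimal`), with `<` definable *without parameters* (automatic in an
ordered structure).  Nothing here is a named fact.

## References

* [PillaySteinhorn1986] A. Pillay, C. Steinhorn, *Definable sets in ordered structures I*,
  Trans. AMS 295 (1986) 565–592, §4 (algebraic = definable closure; exchange).
* [DenBesten2016] M. den Besten, *Wilkie's Theorem and the Uniform Real Schanuel Conjecture*,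
  MSc thesis, Utrecht 2016, Lemma 7.1.6.
* [Dries1998] L. van den Dries, *Tame topology and o-minimal structures*, CUP 1998, Ch. 1,
  (3.3); Ch. 3, (1.2).
-/

open Set FirstOrder FirstOrder.Language

namespace Literature.ModelTheory.ExponentialFields

universe u v

variable {L : Language.{u, v}} {M : Type*} [L.Structure M]

/-! ### Fibres of definable sets -/

/-- **A set definable over `A ∪ {b}` is the fibre at `b` of an `A`-definable set** (the
parameter `b` becomes a variable; Marker 2002, Exercise 1.4.10 (a): definable over `A` =
value of an `A`-definable function). [cite: Marker2002, Exercise 1.4.10 (a)] -/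
theorem exists_definable_fiber {α : Type*} {A : Set M} {b : M} {s : Set (α → M)}
    (hs : (insert b A).Definable L s) :
    ∃ G : Set (α ⊕ Fin 1 → M), A.Definable L G ∧ ∀ v, v ∈ s ↔ Sum.elim v ![b] ∈ G := by
  classical
  rw [Set.definable_iff_exists_formula_sum] at hs
  obtain ⟨φ, rfl⟩ := hs
  let g : ↥(insert b A) ⊕ α → A ⊕ (α ⊕ Fin 1) :=
    Sum.elim (fun p => if h : (p : M) ∈ A then Sum.inl ⟨p, h⟩ else Sum.inr (Sum.inr 0))
      (fun a => Sum.inr (Sum.inl a))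
  refine ⟨{w | (φ.relabel g).Realize (Sum.elim (↑) w)},
    Set.definable_iff_exists_formula_sum.2 ⟨φ.relabel g, rfl⟩, fun v => ?_⟩
  simp only [mem_setOf_eq, Formula.realize_relabel]
  have hcomp : (Sum.elim (fun a : A => (a : M)) (Sum.elim v ![b]) ∘ g) =
      Sum.elim (fun p : ↥(insert b A) => (p : M)) v := by
    funext p
    rcases p with p | a
    · show Sum.elim (fun a : A => (a : M)) (Sum.elim v ![b])
        (if h : (p : M) ∈ A then Sum.inl ⟨p, h⟩ else Sum.inr (Sum.inr 0)) = (p : M)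
      by_cases h : (p : M) ∈ A
      · rw [dif_pos h]; rfl
      · rw [dif_neg h]
        have hp : (p : M) = b := (mem_insert_iff.1 p.2).resolve_right h
        show (![b] : Fin 1 → M) 0 = (p : M)
        rw [hp]; rfl
    · rfl
  rw [hcomp]

/-! ### Points of finite definable sets are definable -/

/-- **The points of a finite `A`-definable subset of the line lie in `dcl(A)`** (with `<`
definable over `A`): the least element of an `A`-definable set is `A`-definable, and one
proceeds by induction (den Besten 2016, proof of Lemma 7.1.6 (iv): "we can express that `b`
is the `j`-th isolated point"; Pillay–Steinhorn 1986, §4). [cite: DenBesten2016, Lemma 7.1.6 (iv)] -/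
theorem subset_definableClosure_of_finite [LinearOrder M] {A : Set M}
    (hlt : A.Definable L {v : Fin 2 → M | v 0 < v 1}) {S : Set M}
    (hS : A.Definable₁ L S) (hfin : S.Finite) : S ⊆ definableClosure L A := by
  classical
  -- induction on the number of elements
  suffices h : ∀ n : ℕ, ∀ S : Set M, A.Definable₁ L S → S.Finite → S.ncard = n →
      S ⊆ definableClosure L A from h _ S hS hfin rfl
  intro n
  induction n with
  | zero =>
    intro S _ hfin hcard
    rw [(Set.ncard_eq_zero hfin).1 hcard]
    exact empty_subset _
  | succ n ih =>
    intro S hS hfin hcard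
    have hne : S.Nonempty := Set.nonempty_iff_ne_empty.2 fun h => by
      rw [h, Set.ncard_empty] at hcard; exact Nat.succ_ne_zero n hcard.symm
    obtain ⟨m, hmS, hm⟩ := Set.exists_min_image S id hfin hne
    -- `{m}` is `A`-definable: `m` is the least element of `S`
    have hT : A.Definable₁ L ({m} : Set M) := by
      have hdef : A.Definable L {v : Fin 1 → M | v 0 ∈ S ∧ ∀ y, y ∈ S → v 0 ≤ y} := by
        refine definable_setOf_and_params hS ?_
        apply definable_setOf_forall_params
        refine definable_setOf_imp_params ?_
          (definable_setOf_le_params hlt (DefinableFun.proj _)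
            (DefinableFun.proj _))
        exact hS.preimage_comp (fun _ : Fin 1 => Sum.inr ())
      show A.Definable L {x : Fin 1 → M | x 0 ∈ ({m} : Set M)}
      refine (congrArg _ ?_).mpr hdef
      ext v
      simp only [mem_setOf_eq, mem_singleton_iff]
      constructor
      · intro hv
        rw [hv]
        exact ⟨hmS, fun y hy => hm y hy⟩
      · rintro ⟨hv, hmin⟩
        exact le_antisymm (hmin m hmS) (hm _ hv)
    have hm_dcl : m ∈ definableClosure L A := hT
    -- the rest of `S`
    have hS' : A.Definable₁ L (S \ {m}) := hS.inter hT.compl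
    have hcard' : (S \ {m}).ncard = n := by
      have := Set.ncard_sdiff_singleton_add_one hmS hfin
      omega
    have hsub := ih (S \ {m}) hS' (hfin.subset fun x hx => hx.1) hcard'
    intro x hx
    by_cases hxm : x = m
    · rw [hxm]; exact hm_dcl
    · exact hsub ⟨hx, hxm⟩

/-! ### Boundaries of definable subsets of the line -/

/-- The boundary points of a finite union of intervals — points every open interval around
which meets both the set and its complement — form a finite set (van den Dries 1998, Ch. 1,
(3.3)(ii): "the boundary `bd(A)` is finite"). [cite: Dries1998, Ch. 1 (3.3)(ii)] -/
theorem finite_setOf_boundary [LinearOrder M] [NoMinOrder M] [NoMaxOrder M] {S : Set M}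
    (hS : IsFiniteUnionOfIntervals S) :
    {x | ∀ c₁ c₂, c₁ < x → x < c₂ →
      (∃ y, c₁ < y ∧ y < c₂ ∧ y ∈ S) ∧ (∃ y, c₁ < y ∧ y < c₂ ∧ y ∉ S)}.Finite := by
  obtain ⟨F, hF⟩ := hS.exists_finset_Ioo_subset_or_disjoint
  refine F.finite_toSet.subset fun x hx => ?_
  by_contra hxF
  obtain ⟨c₁, c₂, hc₁, hc₂, havoid⟩ := exists_Ioo_forall_notMem_of_notMem F hxF
  obtain ⟨⟨y, hy₁, hy₂, hyS⟩, z, hz₁, hz₂, hzS⟩ := hx c₁ c₂ hc₁ hc₂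
  rcases hF c₁ c₂ havoid with h | h
  · exact hzS (h ⟨hz₁, hz₂⟩)
  · exact disjoint_left.1 h ⟨hy₁, hy₂⟩ hyS

/-- The boundary of an `A`-definable subset of the line is `A`-definable (with `<` definable
over `A`) (van den Dries 1998, Ch. 1, (3.4) and its Remark: uses only (O1)). [cite: Dries1998, Ch. 1 (3.4)] -/
theorem definable_setOf_boundary [LinearOrder M] {A : Set M}
    (hlt : A.Definable L {v : Fin 2 → M | v 0 < v 1}) {S : Set M}
    (hS : A.Definable₁ L S) :
    A.Definable L {v : Fin 1 → M | ∀ c₁ c₂, c₁ < v 0 → v 0 < c₂ →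
      (∃ y, c₁ < y ∧ y < c₂ ∧ y ∈ S) ∧ (∃ y, c₁ < y ∧ y < c₂ ∧ y ∉ S)} := by
  apply definable_setOf_forall_params
  apply definable_setOf_forall_params
  refine definable_setOf_imp_params (definable_setOf_lt_params hlt
    (DefinableFun.proj _) (DefinableFun.proj _)) ?_
  refine definable_setOf_imp_params (definable_setOf_lt_params hlt
    (DefinableFun.proj _) (DefinableFun.proj _)) ?_
  refine definable_setOf_and_params ?_ ?_
  · apply definable_setOf_exists_params
    refine definable_setOf_and_params (definable_setOf_lt_params hlt
      (DefinableFun.proj _) (DefinableFun.proj _)) ?_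
    refine definable_setOf_and_params (definable_setOf_lt_params hlt
      (DefinableFun.proj _) (DefinableFun.proj _)) ?_
    exact hS.preimage_comp (fun _ : Fin 1 => Sum.inr ())
  · apply definable_setOf_exists_params
    refine definable_setOf_and_params (definable_setOf_lt_params hlt
      (DefinableFun.proj _) (DefinableFun.proj _)) ?_
    refine definable_setOf_and_params (definable_setOf_lt_params hlt
      (DefinableFun.proj _) (DefinableFun.proj _)) ?_
    exact (hS.preimage_comp (fun _ : Fin 1 => Sum.inr ())).compl

/-! ### Locally constant points carry finitely many values -/

section OMinimal

variable [LinearOrder M] [DenselyOrdered M] [NoMinOrder M] [NoMaxOrder M]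

/-- **A definable function takes only finitely many values at its points of local constancy**
(consequence of the monotonicity theorem, van den Dries 1998, Ch. 3, (1.2): off the finite
exceptional set `F`, two locally constant points not separated by a point of `F` lie in a
common `F`-free interval, on which `g` — being neither strictly monotone there — is constant;
so the value at a locally constant point outside `F` depends only on the set of points of `F`
below it). [cite: Dries1998, Ch. 3 (1.2)] -/
theorem finite_image_setOf_locallyConst (hO : L.IsOMinimal M)
    (hlt : (univ : Set M).Definable L {v : Fin 2 → M | v 0 < v 1}) {g : M → M}
    (hg : (univ : Set M).Definable L {v : Fin 2 → M | v 1 = g (v 0)}) :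
    (g '' {y | ∃ c d, c < y ∧ y < d ∧ ∀ z₁ ∈ Ioo c d, ∀ z₂ ∈ Ioo c d, g z₁ = g z₂}).Finite := by
  classical
  obtain ⟨F, hF⟩ := monotonicity hO hlt hg
  set P : Set M := {y | ∃ c d, c < y ∧ y < d ∧ ∀ z₁ ∈ Ioo c d, ∀ z₂ ∈ Ioo c d, g z₁ = g z₂}
    with hP
  -- two locally constant points outside `F` with the same points of `F` below them have the
  -- same value
  have hsame : ∀ y₁ ∈ P, ∀ y₂ ∈ P, y₁ ∉ F → y₂ ∉ F → y₁ < y₂ →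
      (∀ z ∈ F, ¬ (y₁ < z ∧ z < y₂)) → g y₁ = g y₂ := by
    intro y₁ hy₁ y₂ hy₂ hy₁F hy₂F hlt12 hsep
    obtain ⟨c, hcy₁, hc⟩ := exists_lt_forall_notMem_Ioo F y₁
    obtain ⟨d, hy₂d, hd⟩ := exists_gt_forall_notMem_Ioo F y₂
    have havoid : ∀ z ∈ F, z ∉ Ioo c d := by
      intro z hz hzI
      rcases lt_trichotomy z y₁ with h | rfl | h
      · exact hc z hz ⟨hzI.1, h⟩
      · exact hy₁F hz
      rcases lt_trichotomy z y₂ with h' | rfl | h'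
      · exact hsep z hz ⟨h, h'⟩
      · exact hy₂F hz
      · exact hd z hz ⟨h', hzI.2⟩
    have hy₁I : y₁ ∈ Ioo c d := ⟨hcy₁, hlt12.trans hy₂d⟩
    have hy₂I : y₂ ∈ Ioo c d := ⟨hcy₁.trans hlt12, hy₂d⟩
    rcases hF c d havoid with hconst | ⟨hmono, -⟩
    · exact hconst y₁ hy₁I y₂ hy₂I
    · -- strict monotonicity on `(c, d)` contradicts local constancy at `y₁`
      exfalso
      obtain ⟨c', d', hc', hd', hloc⟩ := hy₁
      obtain ⟨p, hp₁, hp₂⟩ := exists_between (max_lt hcy₁ hc')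
      have hpI : p ∈ Ioo c d := ⟨lt_of_le_of_lt (le_max_left _ _) hp₁, hp₂.trans hy₁I.2⟩
      have hpI' : p ∈ Ioo c' d' := ⟨lt_of_le_of_lt (le_max_right _ _) hp₁, hp₂.trans hd'⟩
      have heq : g p = g y₁ := hloc p hpI' y₁ ⟨hc', hd'⟩
      rcases hmono with hm | ha
      · exact (hm hpI hy₁I hp₂).ne heq
      · exact (ha hpI hy₁I hp₂).ne' heq
  -- hence the value map factors through the finite set of subsets of `F`
  have hfin : (g '' (P ∩ (↑F)ᶜ)).Finite := by
    let key : M → Finset M := fun y => F.filter fun z => z < y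
    have hkey : ∀ y₁ ∈ P ∩ (↑F)ᶜ, ∀ y₂ ∈ P ∩ (↑F)ᶜ, key y₁ = key y₂ → g y₁ = g y₂ := by
      intro y₁ hy₁ y₂ hy₂ hk
      rcases lt_trichotomy y₁ y₂ with h | rfl | h
      · refine hsame y₁ hy₁.1 y₂ hy₂.1 hy₁.2 hy₂.2 h fun z hz hzb => ?_
        have : z ∈ key y₂ := Finset.mem_filter.2 ⟨hz, hzb.2⟩
        rw [← hk] at this
        exact lt_asymm hzb.1 (Finset.mem_filter.1 this).2
      · rfl
      · refine (hsame y₂ hy₂.1 y₁ hy₁.1 hy₂.2 hy₁.2 h fun z hz hzb => ?_).symm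
        have : z ∈ key y₁ := Finset.mem_filter.2 ⟨hz, hzb.2⟩
        rw [hk] at this
        exact lt_asymm hzb.1 (Finset.mem_filter.1 this).2
    -- encode values by subsets of `F` (through `Option M`, to have a default value)
    let φ : Finset M → Option M := fun K =>
      if h : ∃ y ∈ P ∩ (↑F)ᶜ, key y = K then some (g h.choose) else none
    have hsub : g '' (P ∩ (↑F)ᶜ) ⊆ some ⁻¹' ↑(F.powerset.image φ) := by
      rintro _ ⟨y, hy, rfl⟩
      refine Finset.mem_coe.2 (Finset.mem_image.2 ⟨key y, Finset.mem_powerset.2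
        (Finset.filter_subset _ _), ?_⟩)
      have hex : ∃ y' ∈ P ∩ (↑F)ᶜ, key y' = key y := ⟨y, hy, rfl⟩
      show (if h : ∃ y' ∈ P ∩ (↑F)ᶜ, key y' = key y then some (g h.choose) else none) =
        some (g y)
      rw [dif_pos hex, hkey _ hex.choose_spec.1 _ hy hex.choose_spec.2]
    exact (((F.powerset.image φ).finite_toSet).preimage
      (Option.some_injective M).injOn).subset hsub
  have hcov : g '' P ⊆ g '' (P ∩ (↑F)ᶜ) ∪ g '' ↑F := by
    rintro _ ⟨y, hy, rfl⟩
    by_cases hyF : y ∈ F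
    · exact Or.inr ⟨y, hyF, rfl⟩
    · exact Or.inl ⟨y, ⟨hy, hyF⟩, rfl⟩
  exact (hfin.union (F.finite_toSet.image g)).subset hcov

/-! ### Exchange -/

/-- **Exchange for the definable closure in an o-minimal structure** (Pillay–Steinhorn 1986,
§4; den Besten 2016, Lemma 7.1.6 (iv)): if `a ∈ dcl(A ∪ {b})` and `a ∉ dcl(A)` then
`b ∈ dcl(A ∪ {a})`.  Hypotheses: `M` o-minimal on a dense linear order without endpoints, `<`
definable without parameters. [cite: DenBesten2016, Lemma 7.1.6 (iv)] -/
theorem exchange_definableClosure (hO : L.IsOMinimal M)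
    (hlt₀ : (∅ : Set M).Definable L {v : Fin 2 → M | v 0 < v 1})
    {A : Set M} {a b : M} (ha : a ∈ definableClosure L (insert b A))
    (hna : a ∉ definableClosure L A) : b ∈ definableClosure L (insert a A) := by
  classical
  have hltA : A.Definable L {v : Fin 2 → M | v 0 < v 1} := hlt₀.mono (empty_subset _)
  have hltaA : (insert a A).Definable L {v : Fin 2 → M | v 0 < v 1} :=
    hlt₀.mono (empty_subset _)
  have hltU : (univ : Set M).Definable L {v : Fin 2 → M | v 0 < v 1} :=
    hlt₀.mono (empty_subset _)
  /- Step 0: `a = g(b)` for an `A`-definable function `g`. -/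
  obtain ⟨G, hG, hfib⟩ := exists_definable_fiber (α := Fin 1) ha
  -- `R y x`: "`x` is in the fibre at `y`"; `R b x ↔ x = a`
  set R : M → M → Prop := fun y x => Sum.elim ![x] ![y] ∈ G with hR
  have hRb : ∀ x, R b x ↔ x = a := fun x => by
    have h := hfib ![x]
    simp only [mem_setOf_eq, Matrix.cons_val_fin_one, mem_singleton_iff] at h
    exact h.symm
  have hRdef : A.Definable L {v : Fin 2 → M | R (v 0) (v 1)} := by
    have h := hG.preimage_comp (Sum.elim (fun _ : Fin 1 => (1 : Fin 2)) (fun _ : Fin 1 => 0))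
    refine (congrArg _ ?_).mpr h
    ext v
    simp only [mem_setOf_eq, mem_preimage]
    have : (v ∘ Sum.elim (fun _ : Fin 1 => (1 : Fin 2)) fun _ : Fin 1 => 0) =
        Sum.elim ![v 1] ![v 0] := by
      funext p; rcases p with p | p <;> simp
    rw [this]
  -- the function `g`
  set Dp : M → Prop := fun y => ∃ x, R y x ∧ ∀ x', R y x' → x' = x with hDp
  let g : M → M := fun y => if h : Dp y then h.choose else y
  have hg_spec : ∀ y, Dp y → R y (g y) ∧ ∀ x', R y x' → x' = g y := by
    intro y hy
    have hgy : g y = hy.choose := dif_pos hy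
    rw [hgy]
    exact hy.choose_spec
  have hDb : Dp b := ⟨a, (hRb a).2 rfl, fun x' hx' => (hRb x').1 hx'⟩
  have hgb : g b = a := ((hRb (g b)).1 (hg_spec b hDb).1)
  have hgdef : A.Definable L {v : Fin 2 → M | v 1 = g (v 0)} := by
    have hD : ∀ {β : Type} [Finite β] (t : (β → M) → M), A.DefinableFun L t →
        A.Definable L {w : β → M | Dp (t w)} := by
      intro β _ t ht
      apply definable_setOf_exists_params
      refine definable_setOf_and_params
        (definable_setOf_rel_params hRdef (ht.comp fun _ => DefinableFun.proj _)
          (DefinableFun.proj _)) ?_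
      apply definable_setOf_forall_params
      refine definable_setOf_imp_params
        (definable_setOf_rel_params hRdef
          ((ht.comp fun _ => DefinableFun.proj _).comp fun _ =>
            DefinableFun.proj _) (DefinableFun.proj _)) ?_
      exact definable_setOf_eq_params (DefinableFun.proj _) (DefinableFun.proj _)
    have hset : {v : Fin 2 → M | v 1 = g (v 0)} =
        {v | (Dp (v 0) ∧ R (v 0) (v 1)) ∨ (¬ Dp (v 0) ∧ v 1 = v 0)} := by
      ext v
      simp only [mem_setOf_eq]
      by_cases h : Dp (v 0)
      · constructor
        · intro hv
          exact Or.inl ⟨h, hv ▸ (hg_spec _ h).1⟩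
        · rintro (⟨-, hRv⟩ | ⟨hn, -⟩)
          · exact (hg_spec _ h).2 _ hRv
          · exact absurd h hn
      · have hgv : g (v 0) = v 0 := dif_neg h
        rw [hgv]
        constructor
        · intro hv; exact Or.inr ⟨h, hv⟩
        · rintro (⟨hd, -⟩ | ⟨-, hv⟩)
          · exact absurd hd h
          · exact hv
    rw [hset]
    refine definable_setOf_or_params
      (definable_setOf_and_params (hD _ (DefinableFun.proj _))
        (definable_setOf_rel_params hRdef (DefinableFun.proj _)
          (DefinableFun.proj _))) ?_
    exact definable_setOf_and_params (definable_setOf_not_params (hD _ (DefinableFun.proj _)))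
      (definable_setOf_eq_params (DefinableFun.proj _) (DefinableFun.proj _))
  /- Step 1: the set `B' = {y | g y = a}` is `(A ∪ {a})`-definable and contains `b`. -/
  have hB'def : (insert a A).Definable₁ L {y | g y = a} :=
    definable_setOf_eq_params (definableFun_apply_params (hgdef.mono (subset_insert a A))
      (DefinableFun.proj (i := 0) _)) (definableFun_const_params _ (mem_insert a A))
  have hB'fui : IsFiniteUnionOfIntervals {y | g y = a} :=
    isFiniteUnionOfIntervals_setOf_params hO hB'def
  by_cases hint : ∃ c₁ c₂, c₁ < b ∧ b < c₂ ∧ Ioo c₁ c₂ ⊆ {y | g y = a}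
  swap
  · /- Step 2: `b` is a boundary point of `B'`, and boundary points are definable. -/
    set Bd : Set M := {x | ∀ c₁ c₂, c₁ < x → x < c₂ →
        (∃ y, c₁ < y ∧ y < c₂ ∧ y ∈ {y | g y = a}) ∧ (∃ y, c₁ < y ∧ y < c₂ ∧ y ∉ {y | g y = a})}
      with hBd
    have hbd : b ∈ Bd := by
      intro c₁ c₂ hc₁ hc₂
      refine ⟨⟨b, hc₁, hc₂, hgb⟩, ?_⟩
      by_contra hcon
      refine hint ⟨c₁, c₂, hc₁, hc₂, fun y hy => ?_⟩
      by_contra hy'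
      exact hcon ⟨y, hy.1, hy.2, hy'⟩
    exact subset_definableClosure_of_finite hltaA (S := Bd) (definable_setOf_boundary hltaA hB'def)
      (finite_setOf_boundary hB'fui) hbd
  · /- Step 3: `b` interior: then `a` is a value taken on an interval, and there are only
    finitely many such values, all in `dcl(A)` — contradiction. -/
    exfalso
    obtain ⟨c₁, c₂, hc₁, hc₂, hsub⟩ := hint
    set V : Set M := {x | ∃ c d, c < d ∧ ∀ y, c < y → y < d → g y = x} with hV
    have haV : a ∈ V := ⟨c₁, c₂, hc₁.trans hc₂, fun y hy₁ hy₂ => hsub ⟨hy₁, hy₂⟩⟩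
    have hVdef : A.Definable₁ L V := by
      apply definable_setOf_exists_params
      apply definable_setOf_exists_params
      refine definable_setOf_and_params (definable_setOf_lt_params hltA
        (DefinableFun.proj _) (DefinableFun.proj _)) ?_
      apply definable_setOf_forall_params
      refine definable_setOf_imp_params (definable_setOf_lt_params hltA
        (DefinableFun.proj _) (DefinableFun.proj _)) ?_
      refine definable_setOf_imp_params (definable_setOf_lt_params hltA
        (DefinableFun.proj _) (DefinableFun.proj _)) ?_
      exact definable_setOf_eq_params (definableFun_apply_params hgdef
        (DefinableFun.proj _)) (DefinableFun.proj _)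
    have hVfin : V.Finite := by
      refine (finite_image_setOf_locallyConst hO hltU (hgdef.mono (subset_univ A))).subset ?_
      rintro x ⟨c, d, hcd, hx⟩
      obtain ⟨y, hy₁, hy₂⟩ := exists_between hcd
      exact ⟨y, ⟨c, d, hy₁, hy₂, fun z₁ hz₁ z₂ hz₂ =>
        (hx z₁ hz₁.1 hz₁.2).trans (hx z₂ hz₂.1 hz₂.2).symm⟩, hx y hy₁ hy₂⟩
    exact hna (subset_definableClosure_of_finite hltA hVdef hVfin haV)

/-- **In an o-minimal structure `dcl` is a pregeometry** (Pillay–Steinhorn 1986, §4; den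
Besten 2016, Lemma 7.1.6): the definable closure `definableClosure L` of an o-minimal
`L`-structure on a dense linear order without endpoints, with `<` definable without
parameters, is extensive, monotone, idempotent, of finite character and satisfies exchange —
an `IsPregeometry` in the sense of `Literature.ModelTheory.Quasiminimal`, so that bases and
dimension (`PregeometryMatroid.lean`) are available for `dcl` (den Besten 2016,
Definitions 7.1.7–7.1.9). [cite: DenBesten2016, Lemma 7.1.6] -/
theorem isPregeometry_definableClosure (hO : L.IsOMinimal M)
    (hlt₀ : (∅ : Set M).Definable L {v : Fin 2 → M | v 0 < v 1}) :
    Literature.ModelTheory.Quasiminimal.IsPregeometry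
      (fun A : Set M => definableClosure L A) where
  subset_cl := subset_definableClosure
  mono := fun _ _ h => definableClosure_mono h
  cl_cl := definableClosure_definableClosure
  finite_character := fun _ _ ha => exists_finite_mem_definableClosure ha
  exchange := fun _ _ _ hab hna => exchange_definableClosure hO hlt₀ hab hna

/-- **`dcl` is a pregeometry in an o-minimal ordered structure** (Pillay–Steinhorn 1986, §4):
the variant for a language with the order symbol interpreted as `≤` (`L.OrderedStructure M`),
where `<` is definable without parameters automatically. [cite: PillaySteinhorn1986, §4] -/
theorem isPregeometry_definableClosure_of_orderedStructure [L.IsOrdered] [L.OrderedStructure M]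
    (hO : L.IsOMinimal M) :
    Literature.ModelTheory.Quasiminimal.IsPregeometry
      (fun A : Set M => definableClosure L A) :=
  isPregeometry_definableClosure hO definable_lt_of_orderedStructure_params

end OMinimal

end Literature.ModelTheory.ExponentialFields
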